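import Mathlib
import Literature.MathematicalPhysics.QuantumFieldTheory.Luscher2010.TrivializingMaps
import Summits.Ventures.LatticeQCDFlow.TrivializingMaps.TruncationDefect
import Summits.Ventures.LatticeQCDFlow.TrivializingMaps.LinkPolynomials
import HarnessLib

/-!
# Link re-indexing transport (volume independence of local estimates)

HONEST FRAMING: exact (Metropolis-corrected) sampling algorithms for lattice gauge theory; figures of merit are
autocorrelation/cost numbers at stated couplings and volumes; no continuum-physics claim.

Lüscher, CMP 293 (2010) 899, §4.4–4.5: the terms of the flow-action series are LOCAL — a functional of the
link variables in a bounded plaquette ball — and all estimates on them are therefore independent of the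
lattice volume. The link derivatives `∂_{e,X}` and the link Laplacian `Δ = -∑_e ∑_a ∂^a_e ∂^a_e` act
link by link and see no lattice geometry, so a functional `u` depending only on a finite link set `A` can be
transported to ANY other lattice along a link map `τ` that separates `A` (`τ e₂ = τ e ⇒ e₂ = e` for
`e ∈ A`): `(τ_* u)(V) = u(V ∘ τ)` (`pushFun`). This file proves that the transport commutes with link
derivatives at links of `A` (`linkDeriv_pushFun`), kills derivatives at links not hit by `A`
(`linkDeriv_pushFun_of_disjoint`), commutes with `Δ` (`linkLap_pushFun`), preserves polynomial degree
(`pushFun_mem_polyL`) and `SU(n)`-valued configurations (`pullCfg_coeConfig`), and that every `SU(n)^E`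
configuration is matched on `A` by a transported one (`exists_pullCfg_congr`). Used in `ExtensiveDefect` to
make the gradient bound for `Δ⁻¹` on `PD m (linkBall R e₀)` uniform in `L`. Reference: M. Lüscher, CMP 293
(2010) 899 [Luscher2010Trivializing, arXiv:0907.5491], §4.4, App. A eq. (A.3).
-/

namespace Summit.Ventures.LatticeQCDFlow.TrivializingMaps

open Literature.MathematicalPhysics.QuantumFieldTheory
open Literature.MathematicalPhysics.QuantumFieldTheory.Luscher2010
open scoped Matrix Matrix.Norms.Frobenius ContDiff

noncomputable section

variable {d L d' L' n : ℕ}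

/-- Pull-back of configurations along a link map `τ`: `(τ^* V)(e) = V(τ e)`. [folklore] -/
def pullCfg (τ : Edge d L → Edge d' L') (V : AmbConfig d' L' n) : AmbConfig d L n := fun e => V (τ e)

/-- Push-forward of functionals along a link map `τ`: `(τ_* u)(V) = u(τ^* V)`. [folklore] -/
def pushFun (τ : Edge d L → Edge d' L') (u : AmbConfig d L n → ℝ) : AmbConfig d' L' n → ℝ :=
  fun V => u (pullCfg τ V)

/-- Unfolding `pullCfg`. [folklore] -/
@[simp] theorem pullCfg_apply (τ : Edge d L → Edge d' L') (V : AmbConfig d' L' n) (e : Edge d L) :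
    pullCfg τ V e = V (τ e) := rfl

/-- Unfolding `pushFun`. [folklore] -/
@[simp] theorem pushFun_apply (τ : Edge d L → Edge d' L') (u : AmbConfig d L n → ℝ) (V : AmbConfig d' L' n) :
    pushFun τ u V = u (pullCfg τ V) := rfl

/-- `SU(n)`-valued configurations pull back to `SU(n)`-valued configurations. [folklore] -/
theorem pullCfg_coeConfig (τ : Edge d L → Edge d' L')
    (U' : GaugeConfig d' L' (Matrix.specialUnitaryGroup (Fin n) ℂ)) :
    pullCfg (n := n) τ (WilsonFlow.coeConfig U') = WilsonFlow.coeConfig fun e => U' (τ e) := rfl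

/-- At a link `e` with singleton `τ`-fibre, updating `V` at `τ e` pulls back to updating `τ^* V` at `e`.
[folklore] -/
theorem pullCfg_update (τ : Edge d L → Edge d' L') {e : Edge d L} (he : ∀ e₂, τ e₂ = τ e → e₂ = e)
    (V : AmbConfig d' L' n) (M : Matrix (Fin n) (Fin n) ℂ) :
    pullCfg τ (Function.update V (τ e) M) = Function.update (pullCfg τ V) e M := by
  funext e₂
  by_cases h : e₂ = e
  · subst h; simp
  · rw [Function.update_of_ne h, pullCfg_apply, pullCfg_apply, Function.update_of_ne fun h' => h (he e₂ h')]

/-- **Transport commutes with link derivatives** at links with singleton fibre: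
`∂_{τe,X}(τ_* u)(V) = (∂_{e,X} u)(τ^* V)`. [cite: Luscher2010Trivializing, App. A eq. (A.3)] -/
theorem linkDeriv_pushFun (τ : Edge d L → Edge d' L') {e : Edge d L} (he : ∀ e₂, τ e₂ = τ e → e₂ = e)
    (X : Matrix (Fin n) (Fin n) ℂ) (u : AmbConfig d L n → ℝ) (V : AmbConfig d' L' n) :
    linkDeriv (τ e) X (pushFun τ u) V = linkDeriv e X u (pullCfg τ V) := by
  unfold linkDeriv
  simp only [pushFun_apply, pullCfg_update τ he, pullCfg_apply]

/-- Function-level form of `linkDeriv_pushFun`: `∂_{τe,X} ∘ τ_* = τ_* ∘ ∂_{e,X}`. [folklore] -/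
theorem linkDeriv_pushFun_eq (τ : Edge d L → Edge d' L') {e : Edge d L} (he : ∀ e₂, τ e₂ = τ e → e₂ = e)
    (X : Matrix (Fin n) (Fin n) ℂ) (u : AmbConfig d L n → ℝ) :
    linkDeriv (τ e) X (pushFun τ u) = pushFun τ (linkDeriv e X u) :=
  funext fun V => linkDeriv_pushFun τ he X u V

/-- A transported functional has vanishing derivative at every link not hit by its dependence set.
[folklore] -/
theorem linkDeriv_pushFun_of_disjoint (τ : Edge d L → Edge d' L') {A : Set (Edge d L)}
    {u : AmbConfig d L n → ℝ} (hu : DependsOn u A) {e' : Edge d' L'} (he' : ∀ e ∈ A, τ e ≠ e')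
    (X : Matrix (Fin n) (Fin n) ℂ) : linkDeriv e' X (pushFun τ u) = fun _ => 0 := by
  funext V
  unfold linkDeriv
  have h : (fun s : ℝ => pushFun τ u (Function.update V e' (NormedSpace.exp ((s : ℂ) • X) * V e'))) =
      fun _ => u (pullCfg τ V) := by
    funext s
    rw [pushFun_apply]
    apply hu
    intro i hi
    rw [pullCfg_apply, pullCfg_apply, Function.update_of_ne (he' i hi)]
  rw [h, deriv_const]

/-- Transport maps link monomials to link monomials (re-indexing the links). [folklore] -/
theorem pushFun_lmonom (τ : Edge d L → Edge d' L') {k : ℕ} (κs : Fin k → LinkCoord d L n) :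
    pushFun τ (lmonom κs) = lmonom fun i => ((τ (κs i).1, (κs i).2) : LinkCoord d' L' n) := by
  funext V
  simp [lmonom, lcoord]

/-- **Transport preserves polynomial degree**: `τ_* (polyL m) ⊆ polyL m`.
[cite: Luscher2010Trivializing, §4.4] -/
theorem pushFun_mem_polyL (τ : Edge d L → Edge d' L') {m : ℕ} {u : AmbConfig d L n → ℝ}
    (hu : u ∈ polyL d L n m) : pushFun τ u ∈ polyL d' L' n m := by
  induction hu using Submodule.span_induction with
  | mem x hx =>
      obtain ⟨⟨k, κs⟩, rfl⟩ := hx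
      rw [pushFun_lmonom]
      exact lmonom_mem (Nat.lt_succ_iff.1 k.2) _
  | zero => exact Submodule.zero_mem _
  | add f g _ _ hf hg => exact Submodule.add_mem _ hf hg
  | smul c f _ hf => exact Submodule.smul_mem _ c hf

/-- Every `SU(n)^E` configuration is matched on `A` by the pull-back of an `SU(n)^{E'}` configuration
(when `τ` separates `A`). [folklore] -/
theorem exists_pullCfg_congr (τ : Edge d L → Edge d' L') {A : Set (Edge d L)}
    (hτ : ∀ e ∈ A, ∀ e₂, τ e₂ = τ e → e₂ = e)
    (U : GaugeConfig d L (Matrix.specialUnitaryGroup (Fin n) ℂ)) :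
    ∃ U' : GaugeConfig d' L' (Matrix.specialUnitaryGroup (Fin n) ℂ),
      ∀ e ∈ A, pullCfg (n := n) τ (WilsonFlow.coeConfig U') e = WilsonFlow.coeConfig U e := by
  classical
  refine ⟨fun e' => if h : ∃ e ∈ A, τ e = e' then U h.choose else 1, fun e he => ?_⟩
  have h : ∃ e₁ ∈ A, τ e₁ = τ e := ⟨e, he, rfl⟩
  rw [pullCfg_apply, WilsonFlow.coeConfig_apply, WilsonFlow.coeConfig_apply, dif_pos h]
  obtain ⟨h1, h2⟩ := h.choose_spec
  rw [hτ e he _ h2]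

/-- **Derivative values transfer**: for `u` depending only on `A` and `e ∈ A`, every value
`∂_{e,X} u(ιU)` on `SU(n)^E` is a value `∂_{τe,X}(τ_* u)(ιU')` on `SU(n)^{E'}`. [folklore] -/
theorem exists_linkDeriv_eq_pushFun (τ : Edge d L → Edge d' L') {A : Set (Edge d L)}
    (hτ : ∀ e ∈ A, ∀ e₂, τ e₂ = τ e → e₂ = e) {u : AmbConfig d L n → ℝ} (hu : u ∈ depOn A)
    {e : Edge d L} (he : e ∈ A) (X : Matrix (Fin n) (Fin n) ℂ)
    (U : GaugeConfig d L (Matrix.specialUnitaryGroup (Fin n) ℂ)) :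
    ∃ U' : GaugeConfig d' L' (Matrix.specialUnitaryGroup (Fin n) ℂ),
      linkDeriv e X u (WilsonFlow.coeConfig U) = linkDeriv (τ e) X (pushFun τ u) (WilsonFlow.coeConfig U') := by
  obtain ⟨U', hU'⟩ := exists_pullCfg_congr (n := n) τ hτ U
  refine ⟨U', ?_⟩
  rw [linkDeriv_pushFun τ (hτ e he) X u]
  exact linkDeriv_mem_depOn e X hu fun i hi => (hU' i hi).symm

variable [NeZero L] [NeZero L']

/-- **Transport commutes with the link Laplacian**: `Δ_B(τ_* u)(V) = (Δ_B u)(τ^* V)` for `u` depending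
only on a set `A` separated by `τ` (links of `E'` not hit by `A` contribute zero; links of `A` are
re-indexed). [cite: Luscher2010Trivializing, §4.2 eq. (4.6), §4.4] -/
theorem linkLap_pushFun (B : SuBasis n) (τ : Edge d L → Edge d' L') {A : Set (Edge d L)}
    (hτ : ∀ e ∈ A, ∀ e₂, τ e₂ = τ e → e₂ = e) {u : AmbConfig d L n → ℝ} (hu : u ∈ depOn A)
    (V : AmbConfig d' L' n) : linkLap B (pushFun τ u) V = linkLap B u (pullCfg τ V) := by
  classical
  unfold linkLap
  congr 1
  set Af := Finset.univ.filter (· ∈ A) with hAf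
  have hL : ∀ e' : Edge d' L', e' ∉ Af.image τ →
      ∑ a, linkDeriv e' (B.T a) (linkDeriv e' (B.T a) (pushFun τ u)) V = 0 := by
    intro e' he'
    have hne : ∀ e ∈ A, τ e ≠ e' := fun e he h => he' (Finset.mem_image.2 ⟨e, by simp [hAf, he], h⟩)
    refine Finset.sum_eq_zero fun a _ => ?_
    rw [linkDeriv_pushFun_of_disjoint τ hu hne]
    unfold linkDeriv; exact deriv_const _ _
  have hR : ∀ e : Edge d L, e ∉ Af →
      ∑ a, linkDeriv e (B.T a) (linkDeriv e (B.T a) u) (pullCfg τ V) = 0 := by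
    intro e he
    have heA : e ∉ A := fun h => he (by simp [hAf, h])
    refine Finset.sum_eq_zero fun a _ => ?_
    rw [linkDeriv_eq_zero_of_not_mem (B.T a) hu heA]
    unfold linkDeriv; exact deriv_const _ _
  rw [← Finset.sum_subset (Finset.subset_univ (Af.image τ)) fun e' _ he' => hL e' he',
    ← Finset.sum_subset (Finset.subset_univ Af) fun e _ he => hR e he,
    Finset.sum_image fun e he e₂ he₂ h => (hτ e₂ (by simpa [hAf] using he₂) e h)]
  refine Finset.sum_congr rfl fun e he => Finset.sum_congr rfl fun a _ => ?_
  have heA : e ∈ A := by simpa [hAf] using he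
  rw [linkDeriv_pushFun_eq τ (hτ e heA) (B.T a) u, linkDeriv_pushFun τ (hτ e heA)]

/-- Pointwise transfer of a sup bound on `Δ_B u` over `SU(n)^E` to `Δ_B(τ_* u)` over `SU(n)^{E'}`.
[folklore] -/
theorem abs_linkLap_pushFun_le (B : SuBasis n) (τ : Edge d L → Edge d' L') {A : Set (Edge d L)}
    (hτ : ∀ e ∈ A, ∀ e₂, τ e₂ = τ e → e₂ = e) {u : AmbConfig d L n → ℝ} (hu : u ∈ depOn A) {M : ℝ}
    (hM : ∀ U : GaugeConfig d L (Matrix.specialUnitaryGroup (Fin n) ℂ), |linkLap B u (WilsonFlow.coeConfig U)| ≤ M)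
    (U' : GaugeConfig d' L' (Matrix.specialUnitaryGroup (Fin n) ℂ)) :
    |linkLap B (pushFun τ u) (WilsonFlow.coeConfig U')| ≤ M := by
  rw [linkLap_pushFun B τ hτ hu, pullCfg_coeConfig]
  exact hM _

end

end Summit.Ventures.LatticeQCDFlow.TrivializingMaps
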